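import Mathlib

/-!
# STUB_IDEAS `stub_heegnerIndexLowerAtTwo` — k = 2, gen 49: the TWIN-SHIFT dictionary, decided digits

Planner seat `sidea-stub_heegnerIndexLowerAtTwo-2-g49` (mode stub-ideation, technique = literature
transfer / typed dictionary).  Crux `SplitBadTwoLowerHalfOfFacts` (stmt-BirchSwinnertonDyer-27851),
stub `stub_heegnerIndexLowerAtTwo` of the LEAD's skeleton `heegner_index_two` (v3, sha f2bd84c029a8a938).

NOTHING HERE PROVES THE STUB, THE CRUX, OR BSD.  This file certifies (0 `sorry`) the elementary
DIGITS used by the idea card `Ideas/stub-heegnerindexloweratwo-k2-g49.md`: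

* §1 Kraus–Connell at `2` for the road-δ twin `A′ = W ⊗ χ_ε`, `ε ∈ {−1, 2, −2}`, `A′` good ordinary at
  `2` (`a₁` odd ⇒ `c₄` odd, `c₆ ≡ 3 (mod 4)`): the naive twist invariants `(ε²c₄, ε³c₆)` violate Kraus's
  test at `2`, the `u = ½`-rescaled ones `(2⁴ε²c₄, 2⁶ε³c₆)` pass it, and no `u = 2^k (k ≥ 1)` model is
  `2`-integral — so `ω_{W,min} = ω_{A′}/(2√ε)` UNIFORMLY over the class (print: Pal 2012 Prop. 2.5
  cases 2(b)i / 2(c)i, `u₂ = ½`; Connell 5.7.3; Cremona, Algorithms §3.2 p. 51).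
* §2 the Chen–Sprang–Taylor (Cai–Shu–Tian 2014, Thm 1.1) constant bookkeeping: with `c_{−1} = 4`,
  `c_{±2} = 8`, `u_K = 1`, `μ(N, D) = 0` and `‖ω_W‖² = ‖ω_{A′}‖²/(4|ε|)` the two explicit Gross–Zagier
  formulas for the SAME value `L′(1, W/K) = L′(1, φ_{A′}, χ̃_ε)` force `[W(K):ℤy_K]·C_{A′} = [W(K):ℤφ⁻¹P_χ]·C_W`
  (indices modulo torsion, `C` = the Manin-type constants of the two parametrisations), hence the
  GZ/CST index shift `t(key) = v₂ C_W − v₂ C_{A′}` (CRITIC-ROWS-g46 l.47 asked for this digit by kit;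
  it is decided in closed form here).
* §3 the (L2a) digit of plan P2: a Frobenius unit root `α` (root of `X² − aX + p`, `a² < 4p`) has
  `|α|² = p`, so `α^k ≠ 1` for `k ≥ 1` — `H⁰(L_n, ℤ₂(α)) = 0` at every FINITE layer of any `2`-adic tower.
* §4 the algebraic consumer form of (G2′): a torsion-free `Λ`-module has no `2`-torsion; and
  `𝔽₂⟦S⟧⟦T⟧` is a domain (the residual two-variable Iwasawa algebra used in the Shapiro backup).
* §5 the decided NEGATIVE door digit of plan P3: an additive automorphism of a group of order `2` is the
  identity (so at `p = 2` any order-`2` Galois-stable line / quotient of `𝐃[𝔪]` "is `μ₂`": doors (a), (b)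
  of Greenberg 2016 Prop. 4.1.1 — tree `Greenberg2016.prop411_selmer_isAlmostDivisible` — are shut for
  the twin, whose `A′[2]` contains the rational point `T`; only door (c) remains).
* §6 the located negative behind the last step of the chain: `f = S + 2` has μ = 0 two-variably and no
  pseudo-null quotient issue, but μ = 1 on the line `S = 0` — the (G1′)+(G2′) ⇒ «μ_ac = 0» step needs a
  VALUE digit (`2 ∤ f(0, T)`), not only pseudo-null control.
-/

set_option linter.dupNamespace false

namespace Summit.BirchSwinnertonDyer.BirchSwinnertonDyer.Cruxes.SplitBadTwoLowerHalfOfFacts.TwinShiftK2G49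

/-! ## §1 Kraus–Connell at 2 for the twin -/

/-- Kraus's integrality test at `2` for a pair `(c₄, c₆)` (already satisfying `c₄³ − c₆² = 1728Δ ≠ 0`
and the test at `3`): there is an INTEGRAL Weierstrass model over `ℤ₂` with these invariants iff
`(c₄ odd ∧ c₆ ≡ −1 (mod 4)) ∨ (16 ∣ c₄ ∧ c₆ ≡ 0, 8 (mod 32))`
[Cremona, *Algorithms for modular elliptic curves* (2nd ed.) §3.2 p. 51 (Laska–Kraus–Connell);
Kraus 1989, Prop. 2]. -/
def KrausAtTwo (c4 c6 : ℤ) : Prop :=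
  (c4 % 2 = 1 ∧ c6 % 4 = 3) ∨ (c4 % 16 = 0 ∧ (c6 % 32 = 0 ∨ c6 % 32 = 8))

/-- Silverman's `b₂ = a₁² + 4a₂`. -/
def b₂ (a1 a2 : ℤ) : ℤ := a1 * a1 + 4 * a2
/-- `b₄ = 2a₄ + a₁a₃`. -/
def b₄ (a1 a3 a4 : ℤ) : ℤ := 2 * a4 + a1 * a3
/-- `b₆ = a₃² + 4a₆`. -/
def b₆ (a3 a6 : ℤ) : ℤ := a3 * a3 + 4 * a6
/-- `c₄ = b₂² − 24 b₄`. -/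
def c₄ (a1 a2 a3 a4 : ℤ) : ℤ := b₂ a1 a2 * b₂ a1 a2 - 24 * b₄ a1 a3 a4
/-- `c₆ = −b₂³ + 36 b₂ b₄ − 216 b₆`. -/
def c₆ (a1 a2 a3 a4 a6 : ℤ) : ℤ :=
  -(b₂ a1 a2 * b₂ a1 a2 * b₂ a1 a2) + 36 * (b₂ a1 a2 * b₄ a1 a3 a4) - 216 * b₆ a3 a6

/-- **Ordinary-at-2 signature.** If `a₁` is odd (good ORDINARY reduction at `2` of an integral model:
`ā₁ ≠ 0` is the Hasse invariant of `y² + ā₁xy + … `), then `c₄` is odd and `c₆ ≡ 3 (mod 4)`; in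
particular `v₂(c₄) = v₂(c₆) = 0`, Pal's "2-adic signature `(0, 0, c)`". -/
theorem c₄_odd_and_c₆_mod_four_of_a₁_odd (a1 a2 a3 a4 a6 : ℤ) (h : a1 % 2 = 1) :
    c₄ a1 a2 a3 a4 % 2 = 1 ∧ c₆ a1 a2 a3 a4 a6 % 4 = 3 := by
  have ha : a1 % 4 = 1 ∨ a1 % 4 = 3 := by omega
  have hsqa : a1 * a1 % 4 = 1 := by
    rcases ha with ha | ha <;> rw [Int.mul_emod, ha] <;> norm_num
  have hb2 : b₂ a1 a2 % 4 = 1 := by unfold b₂; omega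
  unfold c₄ c₆ b₄ b₆
  set B := b₂ a1 a2 with hB
  have hsq : B * B % 4 = 1 := by rw [Int.mul_emod, hb2]; norm_num
  have hcube : B * B * B % 4 = 1 := by rw [Int.mul_emod, hsq, hb2]; norm_num
  constructor <;> omega

/-- **Naive twist invariants fail Kraus at 2.** For `c₄` odd, `c₆ ≡ 3 (mod 4)` and `ε ∈ {−1, 2, −2}`
the invariants `(ε²c₄, ε³c₆)` of the twisted equation `W = A′ ⊗ χ_ε` admit NO integral model. -/
theorem not_krausAtTwo_naive_twist (c4 c6 ε : ℤ) (h4 : c4 % 2 = 1) (h6 : c6 % 4 = 3)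
    (hε : ε = -1 ∨ ε = 2 ∨ ε = -2) : ¬ KrausAtTwo (ε * ε * c4) (ε * ε * ε * c6) := by
  unfold KrausAtTwo
  rcases hε with rfl | rfl | rfl <;> omega

/-- **The `u = ½` rescaling passes Kraus at 2**: `(2⁴ε²c₄, 2⁶ε³c₆)` is realised by an integral model. -/
theorem krausAtTwo_rescaled_twist (c4 c6 ε : ℤ) (h4 : c4 % 2 = 1) (h6 : c6 % 4 = 3)
    (hε : ε = -1 ∨ ε = 2 ∨ ε = -2) :
    KrausAtTwo (16 * (ε * ε * c4)) (64 * (ε * ε * ε * c6)) := by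
  unfold KrausAtTwo
  rcases hε with rfl | rfl | rfl <;> omega

/-- **No smaller model**: for `c₄` odd the `u = 2^k (k ≥ 1)` rescalings `(2^{-4k}ε²c₄, …)` are not even
`2`-integral, since `16 ∤ ε²c₄`.  With the two lemmas above: the minimal model of the twist at `2` is
the `u = ½` one, i.e. `v₂Δ_min(W) = v₂Δ_min(A′) + 6v₂(ε⁶… ) + 12` — Pal 2012 Prop. 2.4/2.5 cases
2(b)i (`ε = −1`: `+12`, `u₂ = ½`) and 2(c)i (`ε = ±2`: `+18`, `u₂ = ½`). -/
theorem not_sixteen_dvd_naive_c₄ (c4 ε : ℤ) (h4 : c4 % 2 = 1) (hε : ε = -1 ∨ ε = 2 ∨ ε = -2) :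
    ¬ (16 : ℤ) ∣ ε * ε * c4 := by
  rcases hε with rfl | rfl | rfl <;> omega

/-! ## §2 The CST constant bookkeeping: the index shift `t(key)` in closed form -/

/-- Two explicit formulas `L = k₁h₁ = k₂h₂` for one NON-ZERO value pin the height ratio. -/
theorem height_ratio_of_two_formulas {L k₁ k₂ h₁ h₂ : ℝ} (hL : L ≠ 0) (h1 : L = k₁ * h₁)
    (h2 : L = k₂ * h₂) (hk₁ : k₁ ≠ 0) : h₁ / h₂ = k₂ / k₁ := by
  have hh₂ : h₂ ≠ 0 := by
    rintro rfl
    exact hL (by simpa using h2)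
  rw [div_eq_div_iff hh₂ hk₁]
  linarith

/-- **The twin index relation.**  Typed shadow of CST14 Thm 1.1 applied twice to the same value
`L′ := L′(1, W/K) = L′(1, φ_{A′}, χ̃_ε) ≠ 0` (Euler factors at `2` trivial on both sides):
* for `(W, 𝟙_K)` (`c = 1`, `u = 1`, `μ = 0`): `L′ · (C_W² · √|D|) = ‖ω_W‖² · ĥ(y_K)`;
* for `(A′, χ̃_ε)` of conductor `c_ε` (`u = 1`, `μ = 0`): `L′ · (C_{A′}² · c_ε · √|D|) = ‖ω_{A′}‖² · ĥ(P_χ)`;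
* Pal 2012 Prop. 2.5 (§1): `‖ω_{A′}‖² = 4|ε| · ‖ω_W‖²`, and `c_ε = 4|ε|` (`c_{−1} = 4`, `c_{±2} = 8`);
* `ĥ(y_K) = i² ĥ(g)`, `ĥ(P_χ) = j² ĥ(g)` for a generator `g` of `W(K)/tors ≅ ℤ` (rank one; `P_χ ∈ φ(W(K))`
  because `φ^τ = −φ` for the `2`-isogeny... twisting isomorphism `φ : W ≃ A′` over `ℚ(√ε)`).
Conclusion: `i · C_{A′} = j · C_W`.  (`nW = ‖ω_W‖²`, `e = |ε|`, `sD = √|D|`.) -/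
theorem twin_index_relation {Lp nW nA CA CW e cε sD hg i j : ℝ} (hnW : 0 < nW) (hCA : 0 < CA)
    (hCW : 0 < CW) (he : 0 < e) (hhg : 0 < hg) (hi : 0 < i) (hj : 0 < j)
    (hc : cε = 4 * e) (hn : nA = 4 * e * nW)
    (hW : Lp * (CW ^ 2 * sD) = nW * (i ^ 2 * hg))
    (hA : Lp * (CA ^ 2 * cε * sD) = nA * (j ^ 2 * hg)) : i * CA = j * CW := by
  subst hc hn
  have h4 : (4 : ℝ) * e ≠ 0 := by positivity
  have hA' : Lp * (CA ^ 2 * sD) = nW * (j ^ 2 * hg) := by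
    apply mul_left_cancel₀ h4
    linear_combination hA
  have key : nW * hg * ((i * CA) ^ 2 - (j * CW) ^ 2) = 0 := by
    linear_combination (CW ^ 2) * hA' - (CA ^ 2) * hW
  have hsq : (i * CA) ^ 2 = (j * CW) ^ 2 := by
    have hpos : nW * hg ≠ 0 := by positivity
    rcases mul_eq_zero.mp key with h | h
    · exact absurd h hpos
    · linarith
  nlinarith [hsq, mul_pos hi hCA, mul_pos hj hCW]

/-- **`t(key)` in closed form.** From `i · C_{A′} = j · C_W` (all positive naturals):
`v₂ i − v₂ C_W = v₂ j − v₂ C_{A′}`, i.e. the Manin-normalised exponent `2v₂(index) − 2v₂(c)` of the stub's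
conclusion is the SAME for the Heegner point `y_K` of `W` (constant `C_W = Dt.c`) and for the genus point
`φ⁻¹P_χ` read through the twin's parametrisation (constant `C_{A′}`); the GZ/CST shift is
`t(key) := v₂ i − v₂ j = v₂ C_W − v₂ C_{A′}`.  For the anchor `A′ = X₀(49)` (identity parametrisation,
`C_{A′} = 1`) this is `t = v₂ C_{W₀}`. -/
theorem padicValNat_index_shift {i j CA CW : ℕ} (hi : i ≠ 0) (hj : j ≠ 0) (hCA : CA ≠ 0)
    (hCW : CW ≠ 0) (h : i * CA = j * CW) :
    (padicValNat 2 i : ℤ) - padicValNat 2 CW = (padicValNat 2 j : ℤ) - padicValNat 2 CA := by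
  have := congrArg (padicValNat 2) h
  rw [padicValNat.mul hi hCA, padicValNat.mul hj hCW] at this
  omega

/-- Corollary in the stub's own currency: `2v₂ i − 2v₂ C_W = 2v₂ j − 2v₂ C_{A′}` (`t_norm(key) = 0`). -/
theorem manin_normalised_exponent_twist_invariant {i j CA CW : ℕ} (hi : i ≠ 0) (hj : j ≠ 0)
    (hCA : CA ≠ 0) (hCW : CW ≠ 0) (h : i * CA = j * CW) :
    2 * (padicValNat 2 i : ℤ) - 2 * (padicValNat 2 CW : ℤ)
      = 2 * (padicValNat 2 j : ℤ) - 2 * (padicValNat 2 CA : ℤ) := by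
  have := padicValNat_index_shift hi hj hCA hCW h
  omega

/-! ## §3 (L2a): a Frobenius unit root is not a root of unity -/

/-- A complex root of `X² − aX + p` with `a, p` real and `a² < 4p` has `|α|² = p`. -/
theorem normSq_of_root {a p : ℝ} (hap : a ^ 2 < 4 * p) {α : ℂ}
    (h : α ^ 2 - (a : ℂ) * α + (p : ℂ) = 0) : Complex.normSq α = p := by
  have hre := congrArg Complex.re h
  have him := congrArg Complex.im h
  simp only [sq, Complex.add_re, Complex.sub_re, Complex.mul_re,
    Complex.ofReal_re, Complex.zero_re, Complex.add_im, Complex.sub_im, Complex.mul_im,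
    Complex.ofReal_im, Complex.zero_im] at hre him
  have hy : α.im * (2 * α.re - a) = 0 := by linear_combination him
  rcases mul_eq_zero.mp hy with hy0 | hx
  · exfalso
    rw [hy0] at hre
    nlinarith [sq_nonneg (2 * α.re - a), hre, hap]
  · rw [Complex.normSq_apply]
    linear_combination (-1 : ℝ) * hre + α.re * hx

/-- **(L2a) digit.** With `1 < p` such a root satisfies `α^k ≠ 1` for every `k ≥ 1`: the unit-root
eigenvalue of Frobenius on the ordinary quotient `Ã′[p^∞]` (`a = a_p(A′)`, `|a| < 2√p`) is not a root of
unity, so `H⁰(L, ℤ_p(α)) = 0` for every FINITE extension `L/ℚ_p` — the exactness input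
`H²(L_n, F⁺A) ≅ H⁰(L_n, ℤ_p(α))^∨ = 0` of plan P2 at every finite layer of the `ℤ₂²`-tower. -/
theorem unitRoot_pow_ne_one {a p : ℝ} (hp : 1 < p) (hap : a ^ 2 < 4 * p) {α : ℂ}
    (h : α ^ 2 - (a : ℂ) * α + (p : ℂ) = 0) {k : ℕ} (hk : k ≠ 0) : α ^ k ≠ 1 := by
  intro hk1
  have hn : Complex.normSq α = p := normSq_of_root hap h
  have h1 : Complex.normSq (α ^ k) = 1 := by rw [hk1]; simp
  rw [map_pow, hn] at h1
  have : (1 : ℝ) < p ^ k := one_lt_pow₀ hp hk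
  linarith

/-- The case of the twin at `2`: `a₂(A′) = ±1` (good ordinary, `|a₂| < 2√2`, `a₂` odd). -/
theorem unitRoot_two_pow_ne_one {a : ℝ} (ha : a = 1 ∨ a = -1) {α : ℂ}
    (h : α ^ 2 - (a : ℂ) * α + (2 : ℝ) = 0) {k : ℕ} (hk : k ≠ 0) : α ^ k ≠ 1 :=
  unitRoot_pow_ne_one (p := 2) (by norm_num) (by rcases ha with rfl | rfl <;> norm_num) h hk

/-! ## §4 (G2′) consumer form: torsion-free ⇒ no 2-torsion; the residual algebra is a domain -/

/-- The algebraic consumer form of (G2′): a torsion-free module over a domain in which `2 ≠ 0` has no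
non-zero `2`-torsion (so every `μ`-type invariant of it at `2` vanishes).  Source of torsion-freeness for
`M_v = H¹_Iw(L̃_v/ℚ₂, F⁺T)`: Nekovář, Selmer Complexes, Prop. 8.11.4 (iii) / 8.11.5 (ii) with `r = 2`. -/
theorem eq_zero_of_two_smul_eq_zero {Λ M : Type*} [CommRing Λ] [AddCommGroup M] [Module Λ M]
    [NoZeroSMulDivisors Λ M] (h2 : (2 : Λ) ≠ 0) (x : M) (hx : (2 : Λ) • x = 0) : x = 0 :=
  (NoZeroSMulDivisors.eq_zero_or_eq_zero_of_smul_eq_zero hx).resolve_left h2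

/-- The residual two-variable Iwasawa algebra `𝔽₂⟦S⟧⟦T⟧` is a domain (Shapiro backup of P2:
`H¹_Iw[2] ↪ H¹(ℚ₂, 𝔽₂⟦Γ⟧(χ̄))`, and a twisted-fixed-point module `{f : (γ − 1)f = 0}` in a domain is `0`). -/
theorem residualIwasawaAlgebra₂_isDomain : IsDomain (PowerSeries (PowerSeries (ZMod 2))) :=
  inferInstance

/-- In a domain, `X • f = 0 ⇒ f = 0` (the fixed-point computation behind the Shapiro backup). -/
theorem eq_zero_of_X_mul_eq_zero (f : PowerSeries (PowerSeries (ZMod 2)))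
    (h : PowerSeries.X * f = 0) : f = 0 :=
  (mul_eq_zero.mp h).resolve_left PowerSeries.X_ne_zero

/-! ## §5 P3's decided negative door digit: Galois acts trivially on a group of order 2 -/

/-- Any additive automorphism of a group of order `2` is the identity.  At `p = 2`, `μ₂(K̄) = {±1}` has
order `2`, so EVERY Galois-stable subgroup / quotient of order `2` of `𝐃[𝔪]` is isomorphic to `μ₂` as a
Galois module: for the twin (`A′(ℚ)[2] ∋ T ≠ 0`, `𝐃[𝔪] = A′[2]`) the line `⟨T⟩` and the quotient
`A′[2]/⟨T⟩` shut doors (a) `¬HasMuSubquotient` and (b) `¬HasMuQuotient` of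
`Greenberg2016.prop411_selmer_isAlmostDivisible`; door (c) (a coreflexive local quotient at a
`LOC⁽¹⁾` prime) is the only one left. -/
theorem addEquiv_apply_eq_self_of_card_two {V : Type*} [AddGroup V] (hV : Nat.card V = 2)
    (f : V ≃+ V) (v : V) : f v = v := by
  by_cases hv : v = 0
  · simp [hv]
  · obtain ⟨y, -, huniq⟩ := (Nat.card_eq_two_iff' (0 : V)).mp hV
    have hfv : f v ≠ 0 := (AddEquiv.map_ne_zero_iff f).mpr hv
    exact (huniq _ hfv).trans (huniq _ hv).symm


/-! ## §6 The μ-leak that survives (G1′): μ is not semicontinuous under specialisation of a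
characteristic series (so «no pseudo-null submodule» does not by itself transfer μ = 0 to a line) -/

/-- **Located negative for the (G1′) ⇒ «μ_ac = 0» step.**  `f = S + 2` (here in one variable `S` over
`ℤ`; read `ℤ ↦ Λ_ac`, `S ↦ T_cyc`): `f` is NOT divisible by `2` (its `Λ₂`-μ-invariant is `0`, and
`Λ₂/(f)` has no non-zero pseudo-null submodule, being cyclic with principal annihilator), yet its
specialisation `S ↦ 0` is `2`, of μ-invariant `1` on the line.  Hence after (G1′) (no pseudo-null leak)
and (G2′) (`μ_loc,v = 0`) the transfer «S3a-cyc ⇒ μ_ac(𝔛_{rel,str}|_{T_cyc = 0}) = 0» still needs a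
VALUE digit: `2 ∤ f_{rel,str}(0, T_ac)`, e.g. one specialisation `f_{rel,str}(0, ζ − 1)` a `2`-adic unit. -/
theorem mu_jumps_under_specialisation :
    PowerSeries.constantCoeff (PowerSeries.X + PowerSeries.C (2 : ℤ)) = 2 ∧
    ¬ ∃ g : PowerSeries ℤ, PowerSeries.X + PowerSeries.C (2 : ℤ) = PowerSeries.C (2 : ℤ) * g := by
  refine ⟨by rw [map_add, PowerSeries.constantCoeff_X, PowerSeries.constantCoeff_C]; norm_num, ?_⟩
  rintro ⟨g, hg⟩
  have h1 := congrArg (PowerSeries.coeff (R := ℤ) 1) hg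
  rw [map_add, PowerSeries.coeff_one_X, PowerSeries.coeff_C, PowerSeries.coeff_C_mul] at h1
  simp only [one_ne_zero, if_false, add_zero] at h1
  omega

end Summit.BirchSwinnertonDyer.BirchSwinnertonDyer.Cruxes.SplitBadTwoLowerHalfOfFacts.TwinShiftK2G49
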